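import Mathlib
import Summits.Ventures.PercRepro2.TypedStarWorld

/-!
# The Harris cone of a pattern world and the law functional
(blind cell PercRepro2, night-3 g29, 2026-08-29; `proofs/NIGHT3-CERT.md` §38 — the certificate side of
the gadget-law method of §36.2 / §37.6, for an arbitrary map from `8` pattern states to the `5`
partitions of three terminals)

`TypedStarWorld.lean` (night-3 g28, p738924) built the Harris cone of the STAR world, where the eight
states are the configurations of three star edges and `π8` sends a state to the partition of the ends
the open edges induce.  Here the same cone is built for ANY map `π : Fin 8 → Fin 5` — in
ThreeTermPartLaw.lean the states are the PATTERNS of a three-terminal part (bits = the three observables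
«`tᵢ ↔ tⱼ` inside the part») and `π = πpat` (`1 ↦ 01`, `2 ↦ 02`, `4 ↦ 12`, two or three bits `↦ ⊤`):

* `pushfP π` (the push-forward of a law to the partitions), `genP π a s μ = μ a · hslack s (pushfP π μ)`
  (the pulled-back Harris generators) with `genP_eq` (an explicit monomial combination through the
  bilinear coefficients `hq` of the nine slacks), `InConeP π` (nonnegative combinations of the `512`
  monomials and the `72` generators);
* the LAW FUNCTIONAL `lawSum n N = Σ n i j k · B8 N (e8 i) (e8 j) (e8 k)` — the symmetrised
  coefficients of a cubic contracted with an array `n` (for the `(2,2,2)`-star, `n` = the typed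
  indicator and `lawSum n = star8`); `lawSum_mono8` (for a copy-symmetric `n`, `Sym3 n`), `lawSum_genP`
  (the contraction of `n` with a generator), `lawSum_cubicOf` (the contraction with a coefficient array);
* **`lawSum_nonneg_of_inConeP`**: for a copy-symmetric nonnegative `n` satisfying the TYPED HARRIS
  condition `TypedHarris π n` (every generator contracts nonnegatively with `n`), the law functional is
  nonnegative on the cone — the abstract positivity behind «`b_k = Σ_g λ_g · g(n̄_Γ) ≥ 0`» of §37.6.

Own work; standard axioms.
-/

namespace Summit.Ventures.PercRepro2

open ThreeTerm TypedStar

namespace Part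

/-! ## The Harris cone of a pattern world -/

section Cone

variable (π : Fin 8 → Fin 5)

/-- The push-forward of a law on `Fin 8` to the five partitions along `π`. -/
def pushfP (μ : Fin 8 → ℚ) : Fin 5 → ℚ := fun p => ∑ i : Fin 8, if π i = p then μ i else 0

/-- The pulled-back Harris generator: `μ a · hslack s (pushfP π μ)`. -/
def genP (a : Fin 8) (s : Fin 9) : (Fin 8 → ℚ) → ℚ := fun μ => μ a * hslack s (pushfP π μ)

/-- A sum over `p` of a fibre indicator of `π` collapses. -/
lemma sum_fibreP (b : Fin 8) (f : Fin 5 → ℚ) : (∑ p : Fin 5, if π b = p then f p else 0) = f (π b) := by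
  rw [Fintype.sum_eq_single (π b) (fun p hp => by simp [Ne.symm hp])]
  simp

/-- A double sum over `(p, q)` of a fibre indicator of `(π b, π c)` collapses. -/
lemma sum_fibre2P (b c : Fin 8) (f : Fin 5 → Fin 5 → ℚ) :
    (∑ p : Fin 5, ∑ q : Fin 5, if π b = p ∧ π c = q then f p q else 0) = f (π b) (π c) := by
  rw [Fintype.sum_eq_single (π b) (fun p hp => Finset.sum_eq_zero fun q _ => by simp [Ne.symm hp])]
  rw [Fintype.sum_eq_single (π c) (fun q hq => by simp [Ne.symm hq])]
  simp

/-- `genP π a s` is an explicit combination of the monomials `mono8 a b c`. -/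
lemma genP_eq (a : Fin 8) (s : Fin 9) :
    genP π a s = fun μ => ∑ b : Fin 8, ∑ c : Fin 8, hq s (π b) (π c) * mono8 a b c μ := by
  funext μ
  simp only [genP, hslack_eq_hq, mono8]
  have hr : ∀ b c : Fin 8, hq s (π b) (π c) * (μ a * μ b * μ c) =
      ∑ p : Fin 5, ∑ q : Fin 5, if π b = p ∧ π c = q then hq s p q * (μ a * μ b * μ c) else 0 := by
    intro b c
    rw [sum_fibre2P π b c (fun p q => hq s p q * (μ a * μ b * μ c))]
  simp only [hr]
  rw [sum4_swap]
  rw [Finset.mul_sum]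
  refine Finset.sum_congr rfl fun p _ => ?_
  rw [Finset.mul_sum]
  refine Finset.sum_congr rfl fun q _ => ?_
  simp only [pushfP]
  rw [mul_assoc, Finset.sum_mul_sum, Finset.mul_sum, Finset.mul_sum]
  refine Finset.sum_congr rfl fun b _ => ?_
  rw [Finset.mul_sum, Finset.mul_sum]
  refine Finset.sum_congr rfl fun c _ => ?_
  split_ifs <;> simp_all
  ring

/-- **The Harris cone of the pattern world**: nonnegative combinations of the `512` monomials and the
`72` pulled-back Harris generators. -/
def InConeP (N : (Fin 8 → ℚ) → ℚ) : Prop :=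
  ∃ (lm : Fin 8 → Fin 8 → Fin 8 → ℚ) (lh : Fin 8 → Fin 9 → ℚ),
    (∀ i j k, 0 ≤ lm i j k) ∧ (∀ a s, 0 ≤ lh a s) ∧
    ∀ μ, N μ = (∑ i, ∑ j, ∑ k, lm i j k * mono8 i j k μ) + ∑ a, ∑ s, lh a s * genP π a s μ

/-- **The typed Harris condition on a law**: every pulled-back Harris generator contracts
nonnegatively with `n`. -/
def TypedHarris (n : Fin 8 → Fin 8 → Fin 8 → ℚ) : Prop :=
  ∀ a s, 0 ≤ ∑ b : Fin 8, ∑ c : Fin 8, hq s (π b) (π c) * n a b c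

end Cone

/-! ## The law functional -/

section LawSum

/-- A copy-symmetric array on `Fin 8`. -/
structure Sym3 (n : Fin 8 → Fin 8 → Fin 8 → ℚ) : Prop where
  /-- symmetry in the first two copies -/
  swap12 : ∀ i j k, n i j k = n j i k
  /-- symmetry in the last two copies -/
  swap23 : ∀ i j k, n i j k = n i k j

/-- **The law functional**: the symmetrised coefficients of a cubic, contracted with `n`. -/
def lawSum (n : Fin 8 → Fin 8 → Fin 8 → ℚ) (N : (Fin 8 → ℚ) → ℚ) : ℚ :=
  ∑ i : Fin 8, ∑ j : Fin 8, ∑ k : Fin 8, n i j k * B8 N (e8 i) (e8 j) (e8 k)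

/-- `lawSum` of a finite sum. -/
lemma lawSum_sum {ι : Type*} (n : Fin 8 → Fin 8 → Fin 8 → ℚ) (t : Finset ι)
    (f : ι → (Fin 8 → ℚ) → ℚ) : lawSum n (fun μ => ∑ g ∈ t, f g μ) = ∑ g ∈ t, lawSum n (f g) := by
  simp only [lawSum, B8_sum, Finset.mul_sum]
  symm
  rw [Finset.sum_comm]
  refine Finset.sum_congr rfl fun i _ => ?_
  rw [Finset.sum_comm]
  refine Finset.sum_congr rfl fun j _ => ?_
  rw [Finset.sum_comm]

/-- `lawSum` of a scalar multiple. -/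
lemma lawSum_smul (n : Fin 8 → Fin 8 → Fin 8 → ℚ) (c : ℚ) (f : (Fin 8 → ℚ) → ℚ) :
    lawSum n (fun μ => c * f μ) = c * lawSum n f := by
  simp only [lawSum, B8_smul, Finset.mul_sum]
  refine Finset.sum_congr rfl fun i _ => Finset.sum_congr rfl fun j _ => Finset.sum_congr rfl fun k _ => ?_
  ring

/-- `lawSum` of a sum of two cubics. -/
lemma lawSum_add (n : Fin 8 → Fin 8 → Fin 8 → ℚ) (f g : (Fin 8 → ℚ) → ℚ) :
    lawSum n (fun μ => f μ + g μ) = lawSum n f + lawSum n g := by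
  simp only [lawSum, B8_add, mul_add, Finset.sum_add_distrib]

/-- A triple sum against three unit-law indicators picks out one entry. -/
lemma sum_e8_triple (n : Fin 8 → Fin 8 → Fin 8 → ℚ) (i j k : Fin 8) :
    (∑ a : Fin 8, ∑ b : Fin 8, ∑ c : Fin 8, n a b c * (e8 a i * e8 b j * e8 c k)) = n i j k := by
  rw [Fintype.sum_eq_single i (fun a ha => Finset.sum_eq_zero fun b _ => Finset.sum_eq_zero fun c _ =>
    by simp [e8_apply, ha])]
  rw [Fintype.sum_eq_single j (fun b hb => Finset.sum_eq_zero fun c _ => by simp [e8_apply, hb])]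
  rw [Fintype.sum_eq_single k (fun c hc => by simp [e8_apply, hc])]
  simp [e8_apply]

/-- **The law functional of a monomial** is the entry of a copy-symmetric `n`. -/
lemma lawSum_mono8 {n : Fin 8 → Fin 8 → Fin 8 → ℚ} (hn : Sym3 n) (i j k : Fin 8) :
    lawSum n (mono8 i j k) = n i j k := by
  unfold lawSum
  simp only [B8_mono8]
  have key : ∀ a b c : Fin 8, n a b c *
      ((e8 a i * e8 b j * e8 c k + e8 a i * e8 c j * e8 b k + e8 b i * e8 a j * e8 c k +
        e8 b i * e8 c j * e8 a k + e8 c i * e8 a j * e8 b k + e8 c i * e8 b j * e8 a k) / 6) =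
      (n a b c * (e8 a i * e8 b j * e8 c k) + n a b c * (e8 a i * e8 b k * e8 c j) +
        n a b c * (e8 a j * e8 b i * e8 c k) + n a b c * (e8 a k * e8 b i * e8 c j) +
        n a b c * (e8 a j * e8 b k * e8 c i) + n a b c * (e8 a k * e8 b j * e8 c i)) / 6 := by
    intro a b c
    ring
  simp only [key, ← Finset.sum_div, Finset.sum_add_distrib]
  rw [sum_e8_triple n i j k, sum_e8_triple n i k j, sum_e8_triple n j i k, sum_e8_triple n k i j,
    sum_e8_triple n j k i, sum_e8_triple n k j i]
  have t1 : n i k j = n i j k := (hn.swap23 i j k).symm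
  have t2 : n j i k = n i j k := (hn.swap12 i j k).symm
  have t3 : n k i j = n i j k := by rw [hn.swap12 k i j, hn.swap23 i k j]
  have t4 : n j k i = n i j k := by rw [hn.swap23 j k i, hn.swap12 j i k]
  have t5 : n k j i = n i j k := by rw [hn.swap12 k j i, t4]
  rw [t1, t2, t3, t4, t5]
  ring

/-- The law functional of a pulled-back Harris generator is its contraction with `n`. -/
lemma lawSum_genP (π : Fin 8 → Fin 5) {n : Fin 8 → Fin 8 → Fin 8 → ℚ} (hn : Sym3 n) (a : Fin 8)
    (s : Fin 9) : lawSum n (genP π a s) = ∑ b : Fin 8, ∑ c : Fin 8, hq s (π b) (π c) * n a b c := by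
  rw [genP_eq, lawSum_sum]
  refine Finset.sum_congr rfl fun b _ => ?_
  rw [lawSum_sum]
  refine Finset.sum_congr rfl fun c _ => ?_
  rw [lawSum_smul, lawSum_mono8 hn]

/-- **The law functional is nonnegative on the Harris cone** for a copy-symmetric nonnegative law
satisfying the typed Harris condition. -/
theorem lawSum_nonneg_of_inConeP (π : Fin 8 → Fin 5) {n : Fin 8 → Fin 8 → Fin 8 → ℚ} (hn : Sym3 n)
    (hn0 : ∀ i j k, 0 ≤ n i j k) (hH : TypedHarris π n) {N : (Fin 8 → ℚ) → ℚ} (h : InConeP π N) :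
    0 ≤ lawSum n N := by
  obtain ⟨lm, lh, hm, hh, heq⟩ := h
  have hN : N = fun μ => (∑ i, ∑ j, ∑ k, lm i j k * mono8 i j k μ) + ∑ a, ∑ s, lh a s * genP π a s μ :=
    funext heq
  rw [hN, lawSum_add]
  apply add_nonneg
  · rw [lawSum_sum]
    refine Finset.sum_nonneg fun i _ => ?_
    rw [lawSum_sum]
    refine Finset.sum_nonneg fun j _ => ?_
    rw [lawSum_sum]
    refine Finset.sum_nonneg fun k _ => ?_
    rw [lawSum_smul, lawSum_mono8 hn]
    exact mul_nonneg (hm i j k) (hn0 i j k)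
  · rw [lawSum_sum]
    refine Finset.sum_nonneg fun a _ => ?_
    rw [lawSum_sum]
    refine Finset.sum_nonneg fun s _ => ?_
    rw [lawSum_smul, lawSum_genP π hn]
    exact mul_nonneg (hh a s) (hH a s)

/-- The cubic with coefficient array `T`. -/
def cubicOf (T : Fin 8 → Fin 8 → Fin 8 → ℚ) : (Fin 8 → ℚ) → ℚ :=
  fun μ => ∑ i : Fin 8, ∑ j : Fin 8, ∑ k : Fin 8, T i j k * mono8 i j k μ

/-- The law functional of a cubic with coefficients `T` is the contraction `Σ n i j k · T i j k`. -/
lemma lawSum_cubicOf {n : Fin 8 → Fin 8 → Fin 8 → ℚ} (hn : Sym3 n) (T : Fin 8 → Fin 8 → Fin 8 → ℚ) :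
    lawSum n (cubicOf T) = ∑ i : Fin 8, ∑ j : Fin 8, ∑ k : Fin 8, n i j k * T i j k := by
  unfold cubicOf
  rw [lawSum_sum]
  refine Finset.sum_congr rfl fun i _ => ?_
  rw [lawSum_sum]
  refine Finset.sum_congr rfl fun j _ => ?_
  rw [lawSum_sum]
  refine Finset.sum_congr rfl fun k _ => ?_
  rw [lawSum_smul, lawSum_mono8 hn, mul_comm]

end LawSum

end Part

end Summit.Ventures.PercRepro2
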